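import Summits.ResolutionOfSingularities.ResolutionOfSingularities.Theorems.HilbertSamuelEliminationCampaignW42ConeJets
import HarnessLib

/-!
# [OURS · L1 W4.2] The cone theorem behind ridge confinement, for ARBITRARY cones: a rational point
# of a cone at which the Hilbert–Samuel function does not drop from its value at the vertex lies in
# Giraud's ridge (campaign s42 of cell res-hironaka, LADDER-RESOLUTION rung L; informal crux
# `RidgeConfinement`, stmt-ResolutionOfSingularities-17845; `--supports`)

HONEST FRAMING. OURS (slot W4.2, prover res-L1-s42-pv-1, gen 2): the non-hypersurface, cone-level
instance of the repaired obstruction O1 («near points lie in `ℙ` of the RIDGE of the tangent cone»).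
This is CLASSICAL mathematics — Hironaka, *Additive groups associated with points of a projective
space*, Ann. of Math. 92 (1970) ("the points near to the vertex are on the Proj of the ridge",
in the words of Berthomieu–Hivert–Mourtada, Contemp. Math. 521 (2010), introduction), Giraud,
*Contact maximal en caractéristique positive*, Ann. Sci. ÉNS 8 (1975) §1.5 (the faîte as the functor
`F(k') = {v | L_v(C_{k'}) ⊆ C_{k'}}`), Cossart–Jannsen–Saito, LNM 2270 (2020) Rem. 18.29 — proved
here by an elementary filtration argument, for EVERY homogeneous ideal (not only hypersurfaces, which
is what the gen-0 files `…CampaignW42RidgeConfinementHypersurface/Local/Quadric.lean` treat), EVERY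
field and EVERY characteristic, at RATIONAL points. NOTHING here is a statement of H. Hironaka's
manuscript [Hironaka2017]. AI review is weaker than expert review.

## Statement

Let `K` be a field, `S = K[X_1, …, X_n]`, `𝔪 = (X_1, …, X_n)` (`MvPolynomial.idealOfVars`),
`I ⊆ S` a homogeneous ideal (`Literature.RingTheory.HilbertSamuel.IsHomogeneousIdeal`), `C = V(I)`
its cone, `v ∈ Kⁿ` a rational point and `𝔪_v = ker(eval v)` its ideal. The Hilbert–Samuel
functions of `C` at the vertex and at `v` are

  `H⁽¹⁾_{C,0}(d) = dim_K S/(I + 𝔪^{d+1})`,  `H⁽¹⁾_{C,v}(d) = dim_K S/(I + 𝔪_v^{d+1}) = dim_K S/(τ_v I + 𝔪^{d+1})`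

(`τ_v = shift v : f ↦ f(X + v)`, `Literature.RingTheory.MvPolynomial.shift`; `τ_v I = I.map (shift v)` is
the ideal of the translated cone `C − v`). We prove:

* `finrank_quotient_map_shift_sup_pow_le` — **semicontinuity along the cone**:
  `H⁽¹⁾_{C,v} ≤ H⁽¹⁾_{C,0}` pointwise, for every `v ∈ Kⁿ`;
* `map_shift_eq_self_of_finrank_le` — **the cone theorem**: if `H⁽¹⁾_{C,0} ≤ H⁽¹⁾_{C,v}` pointwise
  (the Hilbert–Samuel function does not drop at `v`: `v` is «near» to the vertex), then `τ_v I = I`,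
  i.e. `C + v = C`; hence `v ∈ F(C)(K)` (`mem_ridge_of_finrank_le`, Giraud's functor
  `Literature.AlgebraicGeometry.Resolution.ridge`), and conversely (`finrank_quotient_eq_of_mem_ridge`):
  **the `K`-points of the ridge are exactly the rational points of the cone at which the
  Hilbert–Samuel function takes its vertex value**;
* `shift_mem_of_finrank_quotient_ker_eval_le`, `mem_ridge_of_finrank_quotient_ker_eval_le` — the same
  with the hypothesis written at the point `v` itself (`𝔪_v = RingHom.ker (MvPolynomial.eval v)`);
* `mem_ridge_of_finrank_le_baseChange` — the same for points `v ∈ κⁿ` rational over a field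
  extension `κ ⊇ K`, applied to the cone `C ×_K κ` (`coneIdeal κ I`, homogeneous by
  `isHomogeneousIdeal_map`): `v ∈ F(C)(κ)`.

For the blow-up `X' → X` of a permissible centre `D ∋ x` this is the case `X = C_x(X)` a cone,
`D` = its vertex, `x'` a `κ(x)`-rational point of the exceptional divisor `ℙ(C)`: near (no drop of
`H`) ⟹ `x' ∈ ℙ(F(C))`. The general blow-up (the cone `C_{X,D,x} = Spec(gr_𝔭 𝒪 ⊗ k)` of the tree's
`PermissibleBlowupHilbertSamuelLocal.lean`) and NON-rational near points (Hironaka's group schemes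
`B_{ℙ,x'}`, where the residue extension may be inseparable: CJS Ex. 18.30) are NOT treated here.

## Proof (elementary; no standard bases, no Macaulay; toolkit in `…CampaignW42ConeJets.lean`)

With `J = τ_v I` and the jets `jet_d f = Σ_{e ≤ d} f_e` (`ker jet_d = 𝔪^{d+1}`,
`dim S/(J + 𝔪^{d+1}) = dim jet_d(S) − dim jet_d(J)`): `J ∩ S_{≤d} ⊆ jet_d(J)`, `jet_d(I) = I ∩ S_{≤d}` for
homogeneous `I`, and `τ_v : I ∩ S_{≤d} ↪ J ∩ S_{≤d}` — whence semicontinuity; if moreover `H_0 ≤ H_v`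
all these are equalities, every truncation of an element of `J` lies in `J`, so `J` is homogeneous, and
for a form `g ∈ J` of degree `e` the top form of `τ_{−v} g ∈ I` is `g` (top forms are translation
invariant, `homogeneousComponent_shift_of_isHomogeneous`), so `g ∈ I`: `J ⊆ I`, symmetrically `I ⊆ J`.

References (orientation only): H. Hironaka, Ann. of Math. 92 (1970) 327–334; J. Giraud, Ann. Sci. ÉNS 8
(1975) §1.5; J. Berthomieu, P. Hivert, H. Mourtada, Contemp. Math. 521 (2010), Introduction and
Prop.–Def. 2.1; V. Cossart, U. Jannsen, S. Saito, LNM 2270 (2020), Def. 3.13, Thm. 3.14, Rem. 18.29.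
-/

noncomputable section

-- single-conjunct summit: the doubled namespace component `ResolutionOfSingularities` is mandated
set_option linter.dupNamespace false

open MvPolynomial Module
open Literature.RingTheory.MvPolynomial (shift shift_X shift_shift shift_zero shift_injective eval_shift
  totalDegree_shift_le)
open Literature.RingTheory.HilbertSamuel (IsHomogeneousIdeal isHomogeneousIdeal_map)
open Literature.AlgebraicGeometry.Resolution

namespace Summit.ResolutionOfSingularities.ResolutionOfSingularities.Theorems

namespace CampaignW42

universe u v

variable {K : Type u} [Field K] {n : ℕ}

/-! ## Top forms are translation invariant -/

/-- The top homogeneous component of a product: if `deg f ≤ a` and `deg g ≤ b` then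
`(fg)_{a+b} = f_a · g_b`. [folklore] -/
theorem homogeneousComponent_mul_of_totalDegree_le {f g : MvPolynomial (Fin n) K} {a b : ℕ}
    (hf : f.totalDegree ≤ a) (hg : g.totalDegree ≤ b) :
    homogeneousComponent (a + b) (f * g) = homogeneousComponent a f * homogeneousComponent b g := by
  classical
  ext s
  rw [coeff_homogeneousComponent, coeff_mul, coeff_mul]
  split_ifs with hs
  · refine Finset.sum_congr rfl fun p hp => ?_
    rw [Finset.HasAntidiagonal.mem_antidiagonal] at hp
    have hdeg : p.1.degree + p.2.degree = a + b := by rw [← map_add, hp, hs]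
    rw [coeff_homogeneousComponent, coeff_homogeneousComponent]
    by_cases h1 : p.1.degree = a
    · have h2 : p.2.degree = b := by omega
      rw [if_pos h1, if_pos h2]
    · rw [if_neg h1, zero_mul]
      rcases Nat.lt_or_gt_of_ne h1 with h1 | h1
      · have h2 : g.totalDegree < ∑ i ∈ p.2.support, p.2 i :=
          lt_of_le_of_lt hg (by rw [← Finsupp.degree_apply]; omega)
        rw [coeff_eq_zero_of_totalDegree_lt h2, mul_zero]
      · have h2 : f.totalDegree < ∑ i ∈ p.1.support, p.1 i :=
          lt_of_le_of_lt hf (by rw [← Finsupp.degree_apply]; exact h1)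
        rw [coeff_eq_zero_of_totalDegree_lt h2, zero_mul]
  · symm
    refine Finset.sum_eq_zero fun p hp => ?_
    rw [Finset.HasAntidiagonal.mem_antidiagonal] at hp
    rw [coeff_homogeneousComponent, coeff_homogeneousComponent]
    split_ifs with h1 h2
    · exfalso
      apply hs
      rw [← hp, map_add, h1, h2]
    all_goals simp

/-- The top homogeneous component of a product of polynomials of bounded degrees is the product of
their top components. [folklore] -/
theorem homogeneousComponent_prod_of_totalDegree_le {ι : Type*} (t : Finset ι)
    (f : ι → MvPolynomial (Fin n) K) (m : ι → ℕ) (h : ∀ i ∈ t, (f i).totalDegree ≤ m i) :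
    homogeneousComponent (∑ i ∈ t, m i) (∏ i ∈ t, f i) =
      ∏ i ∈ t, homogeneousComponent (m i) (f i) := by
  classical
  induction t using Finset.induction_on with
  | empty => simp
  | insert i t hi ih =>
    rw [Finset.sum_insert hi, Finset.prod_insert hi, Finset.prod_insert hi,
      homogeneousComponent_mul_of_totalDegree_le (h i (Finset.mem_insert_self i t))
        ((totalDegree_finsetProd _ _).trans
          (Finset.sum_le_sum fun j hj => h j (Finset.mem_insert_of_mem hj))),
      ih fun j hj => h j (Finset.mem_insert_of_mem hj)]

/-- `((X_i + c)^k)_k = X_i^k`. [folklore] -/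
theorem homogeneousComponent_X_add_C_pow (i : Fin n) (c : K) (k : ℕ) :
    homogeneousComponent k ((X i + C c : MvPolynomial (Fin n) K) ^ k) = X i ^ k := by
  have h1 : (X i + C c : MvPolynomial (Fin n) K).totalDegree ≤ 1 :=
    (totalDegree_add _ _).trans (max_le (totalDegree_X (R := K) i).le
      (by rw [totalDegree_C]; exact zero_le_one))
  have h := homogeneousComponent_prod_of_totalDegree_le (Finset.range k)
    (fun _ => (X i + C c : MvPolynomial (Fin n) K)) (fun _ => 1) fun _ _ => h1
  simp only [Finset.sum_const, Finset.card_range, smul_eq_mul, mul_one, Finset.prod_const] at h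
  rw [h, map_add, homogeneousComponent_eq_self (isHomogeneous_X K i),
    homogeneousComponent_of_mem (n := 0) (isHomogeneous_C (Fin n) c), if_neg one_ne_zero, add_zero]

/-- The top form of the translate of a monomial is the monomial: `(c (X+a)^s)_{|s|} = c X^s`.
[folklore] -/
theorem homogeneousComponent_shift_monomial (a : Fin n → K) (s : Fin n →₀ ℕ) (c : K) :
    homogeneousComponent s.degree (shift a (monomial s c)) = monomial s c := by
  classical
  have hshift : shift a (monomial s c) = C c * ∏ i, (X i + C (a i)) ^ (s i) := by
    rw [show shift a (monomial s c) = aeval (fun i => X i + C (a i)) (monomial s c) from rfl,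
      aeval_monomial, algebraMap_eq, Finsupp.prod_fintype _ _ (fun i => pow_zero _)]
  rw [hshift, homogeneousComponent_C_mul, Finsupp.degree_eq_sum,
    homogeneousComponent_prod_of_totalDegree_le Finset.univ _ _ (fun i _ => ?_), monomial_eq,
    Finsupp.prod_fintype _ _ (fun i => pow_zero _)]
  · exact congrArg _ (Finset.prod_congr rfl fun i _ => homogeneousComponent_X_add_C_pow i (a i) (s i))
  · calc ((X i + C (a i) : MvPolynomial (Fin n) K) ^ s i).totalDegree
        ≤ s i * (X i + C (a i) : MvPolynomial (Fin n) K).totalDegree := totalDegree_pow _ _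
      _ ≤ s i * 1 := Nat.mul_le_mul_left _ ((totalDegree_add _ _).trans
          (max_le (totalDegree_X (R := K) i).le (by rw [totalDegree_C]; exact zero_le_one)))
      _ = s i := mul_one _

/-- **Top forms are translation invariant**: for a form `g` of degree `e` and any `a ∈ Kⁿ`, the
degree-`e` component of `g(X + a)` is `g` itself. [folklore] -/
theorem homogeneousComponent_shift_of_isHomogeneous (a : Fin n → K) {g : MvPolynomial (Fin n) K}
    {e : ℕ} (hg : g.IsHomogeneous e) : homogeneousComponent e (shift a g) = g := by
  classical
  conv_lhs => rw [g.as_sum]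
  conv_rhs => rw [g.as_sum]
  rw [map_sum, map_sum]
  refine Finset.sum_congr rfl fun s hs => ?_
  have hsd : s.degree = e := by
    rw [Finsupp.degree_apply]
    exact (hg.degree_eq_sum_deg_support hs).symm
  rw [← hsd, homogeneousComponent_shift_monomial]

/-! ## Semicontinuity and the cone theorem -/

/-- If `I` and `τ_v I` are both homogeneous then `τ_v I ⊆ I` (top forms are translation invariant).
[folklore] -/
theorem map_shift_le_of_isHomogeneousIdeal {I : Ideal (MvPolynomial (Fin n) K)} (hI : IsHomogeneousIdeal I)
    (v : Fin n → K) (hJ : IsHomogeneousIdeal (I.map (shift v))) : I.map (shift v) ≤ I := by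
  intro g hg
  rw [← sum_homogeneousComponent g]
  refine Ideal.sum_mem _ fun e _ => ?_
  have h1 := hI _ (shift_neg_mem_of_mem_map_shift v (hJ g hg e)) e
  rwa [homogeneousComponent_shift_of_isHomogeneous (-v) (homogeneousComponent_isHomogeneous e g)] at h1

/-- **Upper semicontinuity of the Hilbert–Samuel function along a cone, at rational points**:
`dim_K S/(τ_v I + 𝔪^{d+1}) ≤ dim_K S/(I + 𝔪^{d+1})`, i.e. `H⁽¹⁾_{C,v}(d) ≤ H⁽¹⁾_{C,0}(d)` for the cone
`C = V(I)` of a homogeneous ideal and every `v ∈ Kⁿ`. [folklore] -/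
theorem finrank_quotient_map_shift_sup_pow_le {I : Ideal (MvPolynomial (Fin n) K)} (hI : IsHomogeneousIdeal I)
    (v : Fin n → K) (d : ℕ) :
    finrank K (MvPolynomial (Fin n) K ⧸ (I.map (shift v) ⊔ idealOfVars (Fin n) K ^ (d + 1))) ≤
      finrank K (MvPolynomial (Fin n) K ⧸ (I ⊔ idealOfVars (Fin n) K ^ (d + 1))) := by
  haveI := finite_range_jet (K := K) (n := n) d
  haveI : Module.Finite K (Submodule.map (jet K n d) ((I.map (shift v)).restrictScalars K)) :=
    Module.Finite.of_injective (Submodule.inclusion LinearMap.map_le_range) (Submodule.inclusion_injective _)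
  have h1 := finrank_quotient_add_finrank_map_jet I d
  have h2 := finrank_quotient_add_finrank_map_jet (I.map (shift v)) d
  have h3 : finrank K (Submodule.map (jet K n d) (I.restrictScalars K)) ≤
      finrank K (Submodule.map (jet K n d) ((I.map (shift v)).restrictScalars K)) :=
    calc finrank K (Submodule.map (jet K n d) (I.restrictScalars K))
        = finrank K ↥(I.restrictScalars K ⊓ restrictTotalDegree (Fin n) K d) := by
          rw [map_jet_eq_of_isHomogeneousIdeal hI]
      _ ≤ finrank K ↥((I.map (shift v)).restrictScalars K ⊓ restrictTotalDegree (Fin n) K d) :=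
          finrank_inf_le_finrank_map_shift_inf I v d
      _ ≤ _ := Submodule.finrank_mono (inf_restrictTotalDegree_le_map_jet _ d)
  omega

/-- **The cone theorem (Hironaka 1970 / Giraud 1975, rational points, every characteristic)**: let
`I ⊆ K[X_1, …, X_n]` be a homogeneous ideal with cone `C = V(I)` and `v ∈ Kⁿ`. If the Hilbert–Samuel
function of `C` at `v` is not smaller than at the vertex — `dim_K S/(I + 𝔪^{d+1}) ≤ dim_K S/(τ_v I + 𝔪^{d+1})`
for all `d` — then `τ_v I = I`: the cone is invariant under the translation by `v`.
[cite: Giraud1975, §1.5] -/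
theorem map_shift_eq_self_of_finrank_le {I : Ideal (MvPolynomial (Fin n) K)} (hI : IsHomogeneousIdeal I)
    (v : Fin n → K)
    (h : ∀ d : ℕ, finrank K (MvPolynomial (Fin n) K ⧸ (I ⊔ idealOfVars (Fin n) K ^ (d + 1))) ≤
      finrank K (MvPolynomial (Fin n) K ⧸ (I.map (shift v) ⊔ idealOfVars (Fin n) K ^ (d + 1)))) :
    I.map (shift v) = I := by
  set J := I.map (shift v) with hJdef
  -- Step 1: every truncation of an element of `J` lies in `J`
  have hJeq : ∀ d : ℕ, Submodule.map (jet K n d) (J.restrictScalars K) =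
      J.restrictScalars K ⊓ restrictTotalDegree (Fin n) K d := fun d => by
    haveI := finite_range_jet (K := K) (n := n) d
    haveI : Module.Finite K (Submodule.map (jet K n d) (J.restrictScalars K)) :=
      Module.Finite.of_injective (Submodule.inclusion LinearMap.map_le_range) (Submodule.inclusion_injective _)
    refine (Submodule.eq_of_le_of_finrank_le (inf_restrictTotalDegree_le_map_jet J d) ?_).symm
    have h1 := finrank_quotient_add_finrank_map_jet I d
    have h2 := finrank_quotient_add_finrank_map_jet J d
    have h3 : finrank K (Submodule.map (jet K n d) (I.restrictScalars K)) =
        finrank K ↥(I.restrictScalars K ⊓ restrictTotalDegree (Fin n) K d) := by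
      rw [map_jet_eq_of_isHomogeneousIdeal hI]
    have h4 : finrank K ↥(I.restrictScalars K ⊓ restrictTotalDegree (Fin n) K d) ≤
        finrank K ↥(J.restrictScalars K ⊓ restrictTotalDegree (Fin n) K d) :=
      finrank_inf_le_finrank_map_shift_inf I v d
    have h5 := h d
    omega
  -- Step 2: `J` is homogeneous
  have hJhom : IsHomogeneousIdeal J := isHomogeneousIdeal_of_jet_mem fun g hg d => by
    have hm : jet K n d g ∈ Submodule.map (jet K n d) (J.restrictScalars K) := ⟨g, hg, rfl⟩
    rw [hJeq d] at hm
    exact hm.1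
  -- Step 3: `J ⊆ I` and `I ⊆ J`
  have hJI : J.map (shift (-v)) = I := by
    refine le_antisymm ?_ fun f hf => ?_
    · rw [Ideal.map_le_iff_le_comap]
      intro g hg
      exact shift_neg_mem_of_mem_map_shift v hg
    · have h1 : shift (-v) (shift v f) = f := by rw [shift_shift, neg_add_cancel, shift_zero]
      rw [← h1]
      exact Ideal.mem_map_of_mem _ (Ideal.mem_map_of_mem _ hf)
  have hJ' : IsHomogeneousIdeal (J.map (shift (-v))) := by
    rw [hJI]
    exact hI
  refine le_antisymm (map_shift_le_of_isHomogeneousIdeal hI v hJhom) ?_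
  have h2 := map_shift_le_of_isHomogeneousIdeal hJhom (-v) hJ'
  rw [hJI] at h2
  exact h2

/-- **Near the vertex ⟹ translation invariance**: under the hypothesis of the cone theorem,
`f(X + v) ∈ I` for every `f ∈ I`. [cite: Giraud1975, §1.5] -/
theorem shift_mem_of_finrank_le {I : Ideal (MvPolynomial (Fin n) K)} (hI : IsHomogeneousIdeal I)
    (v : Fin n → K)
    (h : ∀ d : ℕ, finrank K (MvPolynomial (Fin n) K ⧸ (I ⊔ idealOfVars (Fin n) K ^ (d + 1))) ≤
      finrank K (MvPolynomial (Fin n) K ⧸ (I.map (shift v) ⊔ idealOfVars (Fin n) K ^ (d + 1))))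
    {f : MvPolynomial (Fin n) K} (hf : f ∈ I) : shift v f ∈ I := by
  have hmem : shift v f ∈ I.map (shift v) := Ideal.mem_map_of_mem _ hf
  rwa [map_shift_eq_self_of_finrank_le hI v h] at hmem

/-- **The vertex-near rational points of a cone lie in Giraud's ridge**: under the hypothesis of
the cone theorem, `v ∈ F(C)(K)` (`Literature.AlgebraicGeometry.Resolution.ridge`). This is the
cone-level content of «near points of a blow-up lie in `ℙ` of the ridge» (BHM 2010, Introduction;
CJS Rem. 18.29), for arbitrary cones at rational points. [cite: Giraud1975, §1.5] -/
theorem mem_ridge_of_finrank_le {I : Ideal (MvPolynomial (Fin n) K)} (hI : IsHomogeneousIdeal I)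
    (v : Fin n → K)
    (h : ∀ d : ℕ, finrank K (MvPolynomial (Fin n) K ⧸ (I ⊔ idealOfVars (Fin n) K ^ (d + 1))) ≤
      finrank K (MvPolynomial (Fin n) K ⧸ (I.map (shift v) ⊔ idealOfVars (Fin n) K ^ (d + 1)))) :
    v ∈ ridge K I := by
  rw [mem_ridge_iff]
  intro f hf
  rw [coneIdeal_self] at hf ⊢
  exact shift_mem_of_finrank_le hI v h hf

/-- **Converse**: a `K`-point of the ridge has the Hilbert–Samuel numbers of the vertex
(translation by `v` is an automorphism of the cone). Together with `mem_ridge_of_finrank_le` and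
semicontinuity: `F(C)(K) = {v ∈ Kⁿ | H_{C,v} = H_{C,0}}`. [cite: Giraud1975, §1.5] -/
theorem finrank_quotient_eq_of_mem_ridge {I : Ideal (MvPolynomial (Fin n) K)} (hI : IsHomogeneousIdeal I)
    {v : Fin n → K} (hv : v ∈ ridge K I) (d : ℕ) :
    finrank K (MvPolynomial (Fin n) K ⧸ (I.map (shift v) ⊔ idealOfVars (Fin n) K ^ (d + 1))) =
      finrank K (MvPolynomial (Fin n) K ⧸ (I ⊔ idealOfVars (Fin n) K ^ (d + 1))) := by
  have hle : I.map (shift v) ≤ I := by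
    rw [Ideal.map_le_iff_le_comap]
    intro f hf
    have := mem_ridge_iff.mp hv f (by rw [coneIdeal_self]; exact hf)
    rwa [coneIdeal_self] at this
  refine le_antisymm (finrank_quotient_map_shift_sup_pow_le hI v d) ?_
  -- `jet_d(τ_v I) ⊆ jet_d(I)`, and the jet formula for both ideals
  haveI := finite_range_jet (K := K) (n := n) d
  haveI : Module.Finite K (Submodule.map (jet K n d) (I.restrictScalars K)) :=
    Module.Finite.of_injective (Submodule.inclusion LinearMap.map_le_range) (Submodule.inclusion_injective _)
  have h1 := finrank_quotient_add_finrank_map_jet I d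
  have h2 := finrank_quotient_add_finrank_map_jet (I.map (shift v)) d
  have h3 : finrank K (Submodule.map (jet K n d) ((I.map (shift v)).restrictScalars K)) ≤
      finrank K (Submodule.map (jet K n d) (I.restrictScalars K)) :=
    Submodule.finrank_mono (Submodule.map_mono fun f hf => hle hf)
  omega

/-! ## The hypothesis at the point `v` itself: `𝔪_v = ker(eval v)` -/

/-- **Semicontinuity at the point**: `dim_K S/(I + 𝔪_v^{d+1}) ≤ dim_K S/(I + 𝔪^{d+1})` for a
homogeneous `I` and every `v ∈ Kⁿ` — `H⁽¹⁾_{C,v} ≤ H⁽¹⁾_{C,0}`. [folklore] -/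
theorem finrank_quotient_sup_ker_eval_pow_le {I : Ideal (MvPolynomial (Fin n) K)} (hI : IsHomogeneousIdeal I)
    (v : Fin n → K) (d : ℕ) :
    finrank K (MvPolynomial (Fin n) K ⧸ (I ⊔ RingHom.ker (eval v) ^ (d + 1))) ≤
      finrank K (MvPolynomial (Fin n) K ⧸ (I ⊔ idealOfVars (Fin n) K ^ (d + 1))) := by
  rw [finrank_quotient_sup_ker_eval_pow_eq]
  exact finrank_quotient_map_shift_sup_pow_le hI v d

/-- **The cone theorem at the point `v`**: if `dim_K S/(I + 𝔪^{d+1}) ≤ dim_K S/(I + 𝔪_v^{d+1})` for all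
`d` (the Hilbert–Samuel function of the cone at its rational point `v` is not smaller than at the
vertex), then `I` is stable under `f ↦ f(X + v)`. [cite: Giraud1975, §1.5] -/
theorem shift_mem_of_finrank_quotient_ker_eval_le {I : Ideal (MvPolynomial (Fin n) K)}
    (hI : IsHomogeneousIdeal I) (v : Fin n → K)
    (h : ∀ d : ℕ, finrank K (MvPolynomial (Fin n) K ⧸ (I ⊔ idealOfVars (Fin n) K ^ (d + 1))) ≤
      finrank K (MvPolynomial (Fin n) K ⧸ (I ⊔ RingHom.ker (eval v) ^ (d + 1))))
    {f : MvPolynomial (Fin n) K} (hf : f ∈ I) : shift v f ∈ I :=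
  shift_mem_of_finrank_le hI v (fun d => (h d).trans_eq (finrank_quotient_sup_ker_eval_pow_eq I v d)) hf

/-- **The vertex-near rational points of a cone lie in its ridge**, hypothesis at the point `v`:
`v ∈ F(C)(K)`. [cite: Giraud1975, §1.5] -/
theorem mem_ridge_of_finrank_quotient_ker_eval_le {I : Ideal (MvPolynomial (Fin n) K)}
    (hI : IsHomogeneousIdeal I) (v : Fin n → K)
    (h : ∀ d : ℕ, finrank K (MvPolynomial (Fin n) K ⧸ (I ⊔ idealOfVars (Fin n) K ^ (d + 1))) ≤
      finrank K (MvPolynomial (Fin n) K ⧸ (I ⊔ RingHom.ker (eval v) ^ (d + 1)))) :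
    v ∈ ridge K I :=
  mem_ridge_of_finrank_le hI v fun d => (h d).trans_eq (finrank_quotient_sup_ker_eval_pow_eq I v d)

/-- **Characterisation of the `K`-points of the ridge** of the cone of a homogeneous ideal: `v ∈ F(C)(K)`
iff the Hilbert–Samuel numbers of `C` at `v` are those of the vertex,
`dim_K S/(I + 𝔪_v^{d+1}) = dim_K S/(I + 𝔪^{d+1})` for all `d`. [cite: Giraud1975, §1.5] -/
theorem mem_ridge_iff_finrank_quotient_ker_eval_eq {I : Ideal (MvPolynomial (Fin n) K)}
    (hI : IsHomogeneousIdeal I) (v : Fin n → K) :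
    v ∈ ridge K I ↔ ∀ d : ℕ, finrank K (MvPolynomial (Fin n) K ⧸ (I ⊔ RingHom.ker (eval v) ^ (d + 1))) =
      finrank K (MvPolynomial (Fin n) K ⧸ (I ⊔ idealOfVars (Fin n) K ^ (d + 1))) := by
  constructor
  · intro hv d
    rw [finrank_quotient_sup_ker_eval_pow_eq]
    exact finrank_quotient_eq_of_mem_ridge hI hv d
  · intro h
    exact mem_ridge_of_finrank_quotient_ker_eval_le hI v fun d => (h d).ge

/-! ## Points rational over an extension `κ ⊇ K`: the cone `C ×_K κ` -/

/-- **Base change**: for a field extension `κ ⊇ K` and a point `v ∈ κⁿ` at which the Hilbert–Samuel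
function of the cone `C_κ = V(I · κ[X])` does not drop from its vertex value, `v ∈ F(C)(κ)` — Giraud's
ridge functor evaluated at `κ` (the ideal `I · κ[X] = coneIdeal κ I` is homogeneous,
`isHomogeneousIdeal_map`). [cite: Giraud1975, §1.5] -/
theorem mem_ridge_of_finrank_le_baseChange {κ : Type v} [Field κ] [Algebra K κ]
    {I : Ideal (MvPolynomial (Fin n) K)} (hI : IsHomogeneousIdeal I) (v : Fin n → κ)
    (h : ∀ d : ℕ, finrank κ (MvPolynomial (Fin n) κ ⧸ (coneIdeal κ I ⊔ idealOfVars (Fin n) κ ^ (d + 1))) ≤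
      finrank κ (MvPolynomial (Fin n) κ ⧸ (coneIdeal κ I ⊔ RingHom.ker (eval v) ^ (d + 1)))) :
    v ∈ ridge κ I := by
  have hIκ : IsHomogeneousIdeal (coneIdeal κ I) := isHomogeneousIdeal_map (algebraMap K κ) hI
  rw [mem_ridge_iff]
  intro f hf
  exact shift_mem_of_finrank_quotient_ker_eval_le hIκ v h hf

/-- **Base change, characterisation**: for `κ ⊇ K` and `v ∈ κⁿ`, `v ∈ F(C)(κ)` iff the Hilbert–Samuel
numbers of `C_κ` at `v` equal those at the vertex. [cite: Giraud1975, §1.5] -/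
theorem mem_ridge_iff_finrank_quotient_ker_eval_eq_baseChange {κ : Type v} [Field κ] [Algebra K κ]
    {I : Ideal (MvPolynomial (Fin n) K)} (hI : IsHomogeneousIdeal I) (v : Fin n → κ) :
    v ∈ ridge κ I ↔ ∀ d : ℕ,
      finrank κ (MvPolynomial (Fin n) κ ⧸ (coneIdeal κ I ⊔ RingHom.ker (eval v) ^ (d + 1))) =
        finrank κ (MvPolynomial (Fin n) κ ⧸ (coneIdeal κ I ⊔ idealOfVars (Fin n) κ ^ (d + 1))) := by
  have hIκ : IsHomogeneousIdeal (coneIdeal κ I) := isHomogeneousIdeal_map (algebraMap K κ) hI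
  have key := mem_ridge_iff_finrank_quotient_ker_eval_eq hIκ v
  -- `F(C)(κ) = F(C_κ)(κ)`: both are `{v | τ_v (I κ[X]) ⊆ I κ[X]}`
  have hridge : v ∈ ridge κ I ↔ v ∈ ridge κ (coneIdeal κ I) := by
    rw [mem_ridge_iff, mem_ridge_iff, coneIdeal_self]
  rw [hridge]
  exact key

end CampaignW42

end Summit.ResolutionOfSingularities.ResolutionOfSingularities.Theorems
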